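import Summits.CriticalPhenomena.PercolationContinuityZ3.Theorems.PercNearOneGluingNoHeavyConstsTwoSourceBHKAntitone
import HarnessLib

/-!
# Two-source van den Berg–Häggström–Kahn, MIXED form (one increasing and one decreasing functional)
# (PAPER-2 track (ii); seat `prim-consts-2`, gen 16)

builds on p205010 (kernel theorem, internal audit signed; external expert review pending).  Support file
(`--supports stmt-CriticalPhenomena-4575`); memos `run/shared/lean/prim/consts/FROM-prim-consts-2-g15-TWO-SOURCE.md` §0(1) (where this
form was announced numerically and left to this gen) and `FROM-prim-consts-2-g16-*.md`.  Theorems only (the bookkeeping defs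
`rCS`, `rDS`, `blockES` are those of `…ConstsTwoSourceBHKCore.lean`); no sorries; standard axioms.

This completes the two-source family `Consts.TwoSource.core₂` (both functionals increasing: sources with union against
intersection of the repelled sets), `Consts.TwoSource.core₂_anti` (both decreasing: the source lattice flipped) by the
MIXED member — `F` increasing travels to the JOIN of the two (source, repelled) pairs, `G` decreasing to their MEET:

* `Consts.TwoSource.core₂_mixed` — for `S, S', X, Y ⊆ U`, `F ≥ 0` increasing and `G ≥ 0` antitone (sum form, percolation
  restricted to `U`):
  `E[F(C_S) G(C_S) 1{S↮X}] · P(S'↮Y) ≤ E[F(C_{S∪S'}) 1{S∪S' ↮ X∩Y}] · E[G(C_{S∩S'}) 1{S∩S' ↮ X∪Y}]`.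
* `Consts.twoSource_twoSet_mixed` — the same in measure form (`μ = prodBernoulli w`):
  `(∫_{S↮X} F(C_S) G(C_S)) · μ(S'↮Y) ≤ (∫_{S∪S'↮X∩Y} F(C_{S∪S'})) · (∫_{S∩S'↮X∪Y} G(C_{S∩S'}))`.
* `Consts.twoSource_sameSource_mixed` — `S = S'`: `(∫_{S↮X} F G(C_S)) · μ(S↮Y) ≤ (∫_{S↮X∩Y} F(C_S)) · (∫_{S↮X∪Y} G(C_S))`;
  at `X = Y` this is the negative correlation of an increasing and a decreasing functional of `C_S` given `{S ↮ X}`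
  (van den Berg–Häggström–Kahn, Thm 1.3 with Remark 2), at general `X, Y` it moves the increasing functional to the
  SMALLER repelled set and the decreasing one to the LARGER.
Proof: BHK's induction on the vertex set exactly as in `core₂` / `core₂_anti` (condition on the open star of `Z = X∩Y`,
`step_sum_set`, Ahlswede–Daykin on the star lattice with `F` on the MEET star and `G` on the JOIN star, the induction
hypothesis at the repelled sets `(X∖Z) ∪ 𝔰_a`, `(Y∖Z) ∪ 𝔰_b`); base case `X ∩ Y = ∅`: the pointwise source monotonicities
`F(C_S) ≤ F(C_{S∪S'})`, `G(C_S) 1{S↮X} ≤ G(C_{S∩S'}) 1{S∩S'↮X}`, `1{S'↮Y} ≤ 1{S∩S'↮Y}`, then Harris increasing/decreasing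
and Harris decreasing/decreasing.  Not in print in this form; derived here.  Exact numerical check before the proof
(engine `prim-consts-2/g15/engines/master_mixed.py`, random weights, n ≤ 5, `G` over ALL decreasing 0/1 functionals by
closure): 0 violations / 436.
[cite: VandenbergHaggstromKahn2005, Thm. 1.1 (pp. 3–5), Thm. 1.3 (p. 6), Remark 2 after Thm. 1.2 (p. 5)]
-/

noncomputable section

namespace Summit.CriticalPhenomena.PercolationContinuityZ3.Theorems

open MeasureTheory Set Literature.Probability.LatticeModels Literature.Probability.Percolation
open Literature.Probability.Percolation.BHK2006 DecisionTree
open scoped Classical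

namespace Consts

namespace TwoSource

variable {V : Type*} [Fintype V]

/-- **Two-source BHK, MIXED form (sum form, percolation restricted to `U`).**  For `S, S', X, Y ⊆ U`, `F ≥ 0`
increasing and `G ≥ 0` antitone:
`E[F(C_S) G(C_S) 1{S↮X}] · P(S'↮Y) ≤ E[F(C_{S∪S'}) 1{S∪S' ↮ X∩Y}] · E[G(C_{S∩S'}) 1{S∩S' ↮ X∪Y}]`.
[cite: VandenbergHaggstromKahn2005, Thm. 1.1 (pp. 3–5), Thm. 1.3 (p. 6) — two-source mixed form derived here] -/
theorem core₂_mixed (w : Sym2 V → ℝ) (hw0 : ∀ e, 0 ≤ w e) (hw1 : ∀ e, w e ≤ 1)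
    (hm : ∑ ω, weight w ω = 1) (U : Finset V) :
    ∀ (S S' : Set V), S ⊆ ↑U → S' ⊆ ↑U → ∀ (X Y : Set V), X ⊆ ↑U → Y ⊆ ↑U →
    ∀ (F G : Set (Sym2 V) → ℝ), Monotone F → Antitone G → (∀ a, 0 ≤ F a) → (∀ a, 0 ≤ G a) →
    (∑ ω, weight w ω * (F (rCS U S ω) * G (rCS U S ω) * ind (rDS U S X) ω)) *
      (∑ ω, weight w ω * ind (rDS U S' Y) ω) ≤
    (∑ ω, weight w ω * (F (rCS U (S ∪ S') ω) * ind (rDS U (S ∪ S') (X ∩ Y)) ω)) *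
      (∑ ω, weight w ω * (G (rCS U (S ∩ S') ω) * ind (rDS U (S ∩ S') (X ∪ Y)) ω)) := by
  induction U using Finset.strongInduction with
  | H U ih =>
  intro S S' hSU hS'U X Y hXU hYU F G hF hG hF0 hG0
  have hRHS : 0 ≤ (∑ ω, weight w ω * (F (rCS U (S ∪ S') ω) * ind (rDS U (S ∪ S') (X ∩ Y)) ω)) *
      (∑ ω, weight w ω * (G (rCS U (S ∩ S') ω) * ind (rDS U (S ∩ S') (X ∪ Y)) ω)) :=
    mul_nonneg (sum_ind_nonneg hw0 hw1 (fun _ => hF0 _) _) (sum_ind_nonneg hw0 hw1 (fun _ => hG0 _) _)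
  by_cases hSX : ∃ s ∈ S, s ∈ X
  · obtain ⟨s, hs, hsX⟩ := hSX
    have h0 : ∑ ω, weight w ω * (F (rCS U S ω) * G (rCS U S ω) * ind (rDS U S X) ω) = 0 :=
      Finset.sum_eq_zero fun ω _ => by
        rw [rDS_eq_empty hs hsX, ind_of_not_mem (Set.notMem_empty ω)]; ring
    rw [h0, zero_mul]; exact hRHS
  by_cases hSY : ∃ s ∈ S', s ∈ Y
  · obtain ⟨s, hs, hsY⟩ := hSY
    have h0 : ∑ ω, weight w ω * ind (rDS U S' Y) ω = 0 :=
      Finset.sum_eq_zero fun ω _ => by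
        rw [rDS_eq_empty hs hsY, ind_of_not_mem (Set.notMem_empty ω)]; ring
    rw [h0, mul_zero]; exact hRHS
  push Not at hSX hSY
  set Z : Finset V := U.filter fun v => v ∈ X ∧ v ∈ Y with hZ
  have hZU : Z ⊆ U := Finset.filter_subset _ _
  have hmemZ : ∀ v, v ∈ Z ↔ v ∈ X ∧ v ∈ Y := fun v => by
    simp only [hZ, Finset.mem_filter, and_iff_right_iff_imp]
    exact fun h => hXU h.1
  have hSZ : ∀ s ∈ S, s ∉ Z := fun s hs h => hSX s hs ((hmemZ s).1 h).1
  have hS'Z : ∀ s ∈ S', s ∉ Z := fun s hs h => hSY s hs ((hmemZ s).1 h).2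
  have hSS'Z : ∀ s ∈ S ∪ S', s ∉ Z := fun s hs => hs.elim (hSZ s) (hS'Z s)
  have hSiZ : ∀ s ∈ S ∩ S', s ∉ Z := fun s hs => hSZ s hs.1
  rcases Z.eq_empty_or_nonempty with hZe | hZne
  · /- base case: pointwise source monotonicities, Harris increasing/decreasing, Harris decreasing/decreasing -/
    have hXY : ∀ ω, ind (rDS U (S ∪ S') (X ∩ Y)) ω = 1 := fun ω =>
      ind_of_mem fun s _ x hx _ => by
        have : x ∈ Z := (hmemZ x).2 hx
        rw [hZe] at this
        exact absurd this (Finset.notMem_empty x)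
    simp_rw [hXY, mul_one]
    set f : Set (Sym2 V) → ℝ := fun ω => F (rCS U (S ∪ S') ω) with hf
    set g₁ : Set (Sym2 V) → ℝ := fun ω => G (rCS U (S ∩ S') ω) * ind (rDS U (S ∩ S') X) ω with hg₁
    set g₂ : Set (Sym2 V) → ℝ := fun ω => ind (rDS U (S ∩ S') Y) ω with hg₂
    have hfm : Monotone f := fun a b hab => hF (rCS_mono U _ hab)
    have hg₁a : Antitone g₁ := fun a b hab => mul_le_mul (hG (rCS_mono U _ hab))
      (ind_rDS_antitone U _ X hab) (ind_nonneg _ _) (hG0 _)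
    have hg₂a : Antitone g₂ := ind_rDS_antitone U _ Y
    have hg₁M : ∀ a, g₁ a ≤ G ∅ := fun a =>
      (mul_le_of_le_one_right (hG0 _) (ind_le_one _ _)).trans (hG (Set.empty_subset _))
    have hg₂M : ∀ a, g₂ a ≤ 1 := fun a => ind_le_one _ _
    have hf0 : ∀ a, 0 ≤ f a := fun _ => hF0 _
    have hg₁0 : ∀ a, 0 ≤ g₁ a := fun _ => mul_nonneg (hG0 _) (ind_nonneg _ _)
    have hg₂0 : ∀ a, 0 ≤ g₂ a := fun _ => ind_nonneg _ _
    -- pointwise source monotonicities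
    have h1 : ∑ ω, weight w ω * (F (rCS U S ω) * G (rCS U S ω) * ind (rDS U S X) ω) ≤
        ∑ ω, weight w ω * (f ω * g₁ ω) := by
      refine Finset.sum_le_sum fun ω _ => mul_le_mul_of_nonneg_left ?_ (weight_nonneg hw0 hw1 ω)
      have e : F (rCS U S ω) * G (rCS U S ω) * ind (rDS U S X) ω =
          F (rCS U S ω) * (G (rCS U S ω) * ind (rDS U S X) ω) := by ring
      rw [e]
      exact mul_le_mul (hF (rCS_mono_source U subset_union_left ω))
        (mul_le_mul (hG (rCS_mono_source U inter_subset_left ω))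
          (ind_mono (rDS_antitone_source (U := U) (X := X) inter_subset_left) ω) (ind_nonneg _ _) (hG0 _))
        (mul_nonneg (hG0 _) (ind_nonneg _ _)) (hF0 _)
    have h2 : ∑ ω, weight w ω * ind (rDS U S' Y) ω ≤ ∑ ω, weight w ω * g₂ ω :=
      Finset.sum_le_sum fun ω _ => mul_le_mul_of_nonneg_left
        (ind_mono (rDS_antitone_source (U := U) (X := Y) inter_subset_right) ω) (weight_nonneg hw0 hw1 ω)
    -- Harris increasing/decreasing, then decreasing/decreasing
    have h3 : ∑ ω, weight w ω * (f ω * g₁ ω) ≤ (∑ ω, weight w ω * f ω) * ∑ ω, weight w ω * g₁ ω :=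
      harris_mono_anti hw0 hw1 hm hf0 hfm hg₁a hg₁M
    have h4 : (∑ ω, weight w ω * g₁ ω) * (∑ ω, weight w ω * g₂ ω) ≤ ∑ ω, weight w ω * (g₁ ω * g₂ ω) :=
      harris_anti_anti hw0 hw1 hm hg₁a hg₂a hg₁M hg₂M
    have h5 : ∑ ω, weight w ω * (g₁ ω * g₂ ω) ≤
        ∑ ω, weight w ω * (G (rCS U (S ∩ S') ω) * ind (rDS U (S ∩ S') (X ∪ Y)) ω) := by
      refine Finset.sum_le_sum fun ω _ => mul_le_mul_of_nonneg_left ?_ (weight_nonneg hw0 hw1 ω)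
      have e : g₁ ω * g₂ ω = G (rCS U (S ∩ S') ω) *
          (ind (rDS U (S ∩ S') X) ω * ind (rDS U (S ∩ S') Y) ω) := by simp only [hg₁, hg₂]; ring
      rw [e, ← ind_inter]
      exact mul_le_mul_of_nonneg_left (ind_mono (rDS_inter_subset_union U _ X Y) ω) (hG0 _)
    have hfn : 0 ≤ ∑ ω, weight w ω * f ω :=
      Finset.sum_nonneg fun ω _ => mul_nonneg (weight_nonneg hw0 hw1 ω) (hf0 _)
    have hg₁n : 0 ≤ ∑ ω, weight w ω * g₁ ω :=
      Finset.sum_nonneg fun ω _ => mul_nonneg (weight_nonneg hw0 hw1 ω) (hg₁0 _)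
    have hg₂n : 0 ≤ ∑ ω, weight w ω * g₂ ω :=
      Finset.sum_nonneg fun ω _ => mul_nonneg (weight_nonneg hw0 hw1 ω) (hg₂0 _)
    have hYn : 0 ≤ ∑ ω, weight w ω * ind (rDS U S' Y) ω :=
      Finset.sum_nonneg fun ω _ => mul_nonneg (weight_nonneg hw0 hw1 ω) (ind_nonneg _ _)
    calc (∑ ω, weight w ω * (F (rCS U S ω) * G (rCS U S ω) * ind (rDS U S X) ω)) *
          (∑ ω, weight w ω * ind (rDS U S' Y) ω)
        ≤ (∑ ω, weight w ω * (f ω * g₁ ω)) * (∑ ω, weight w ω * g₂ ω) :=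
          mul_le_mul h1 h2 hYn (Finset.sum_nonneg fun ω _ => mul_nonneg (weight_nonneg hw0 hw1 ω)
            (mul_nonneg (hf0 _) (hg₁0 _)))
      _ ≤ ((∑ ω, weight w ω * f ω) * ∑ ω, weight w ω * g₁ ω) * (∑ ω, weight w ω * g₂ ω) :=
          mul_le_mul_of_nonneg_right h3 hg₂n
      _ = (∑ ω, weight w ω * f ω) * ((∑ ω, weight w ω * g₁ ω) * ∑ ω, weight w ω * g₂ ω) := by ring
      _ ≤ (∑ ω, weight w ω * f ω) * ∑ ω, weight w ω * (g₁ ω * g₂ ω) :=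
          mul_le_mul_of_nonneg_left h4 hfn
      _ ≤ (∑ ω, weight w ω * f ω) *
          ∑ ω, weight w ω * (G (rCS U (S ∩ S') ω) * ind (rDS U (S ∩ S') (X ∪ Y)) ω) :=
          mul_le_mul_of_nonneg_left h5 hfn
  · /- inductive step: as in `core₂`, with `F` on the MEET star and `G` on the JOIN star -/
    have hss : U \ Z ⊂ U := Finset.sdiff_ssubset hZU hZne
    have hSU' : S ⊆ ↑(U \ Z) := fun s hs => by
      rw [Finset.coe_sdiff]; exact ⟨hSU hs, fun h => hSZ s hs h⟩
    have hS'U' : S' ⊆ ↑(U \ Z) := fun s hs => by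
      rw [Finset.coe_sdiff]; exact ⟨hS'U hs, fun h => hS'Z s hs h⟩
    have hZX : (↑Z : Set V) ⊆ X := fun v hv => ((hmemZ v).1 hv).1
    have hZY : (↑Z : Set V) ⊆ Y := fun v hv => ((hmemZ v).1 hv).2
    have hZXY : (↑Z : Set V) ⊆ X ∩ Y := fun v hv => (hmemZ v).1 hv
    have hZXuY : (↑Z : Set V) ⊆ X ∪ Y := fun v hv => Or.inl (((hmemZ v).1 hv).1)
    have e1 : ∑ ω, weight w ω * (F (rCS U S ω) * G (rCS U S ω) * ind (rDS U S X) ω) =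
        ∑ ω, weight w ω * blockES w (U \ Z) S (fun a => F a * G a) (X \ ↑Z) (rS U Z ω) :=
      step_sum_set hZU hSZ hZX w hm (fun a => F a * G a)
    have e2 : ∑ ω, weight w ω * ind (rDS U S' Y) ω =
        ∑ ω, weight w ω * blockES w (U \ Z) S' (fun _ => 1) (Y \ ↑Z) (rS U Z ω) := by
      have := step_sum_set hZU hS'Z hZY w hm (fun _ => 1)
      simpa only [one_mul] using this
    have e3 : ∑ ω, weight w ω * (F (rCS U (S ∪ S') ω) * ind (rDS U (S ∪ S') (X ∩ Y)) ω) =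
        ∑ ω, weight w ω * blockES w (U \ Z) (S ∪ S') F ((X ∩ Y) \ ↑Z) (rS U Z ω) :=
      step_sum_set hZU hSS'Z hZXY w hm F
    have e4 : ∑ ω, weight w ω * (G (rCS U (S ∩ S') ω) * ind (rDS U (S ∩ S') (X ∪ Y)) ω) =
        ∑ ω, weight w ω * blockES w (U \ Z) (S ∩ S') G ((X ∪ Y) \ ↑Z) (rS U Z ω) :=
      step_sum_set hZU hSiZ hZXuY w hm G
    rw [e1, e2, e3, e4]
    refine four_functions_theorem_univ
      (fun ω => weight w ω * blockES w (U \ Z) S (fun a => F a * G a) (X \ ↑Z) (rS U Z ω))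
      (fun ω => weight w ω * blockES w (U \ Z) S' (fun _ => 1) (Y \ ↑Z) (rS U Z ω))
      (fun ω => weight w ω * blockES w (U \ Z) (S ∪ S') F ((X ∩ Y) \ ↑Z) (rS U Z ω))
      (fun ω => weight w ω * blockES w (U \ Z) (S ∩ S') G ((X ∪ Y) \ ↑Z) (rS U Z ω))
      (fun ω => mul_nonneg (weight_nonneg hw0 hw1 ω)
        (blockES_nonneg hw0 hw1 _ _ (fun a => mul_nonneg (hF0 a) (hG0 a)) _ _))
      (fun ω => mul_nonneg (weight_nonneg hw0 hw1 ω)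
        (blockES_nonneg hw0 hw1 _ _ (fun _ => zero_le_one) _ _))
      (fun ω => mul_nonneg (weight_nonneg hw0 hw1 ω) (blockES_nonneg hw0 hw1 _ _ hF0 _ _))
      (fun ω => mul_nonneg (weight_nonneg hw0 hw1 ω) (blockES_nonneg hw0 hw1 _ _ hG0 _ _))
      fun a b => ?_
    set Sa := rS U Z a with hSa
    set Sb := rS U Z b with hSb
    have hX1 : X \ ↑Z ∪ Sa ⊆ ↑(U \ Z) := Set.union_subset
      (fun v hv => by rw [Finset.coe_sdiff]; exact ⟨hXU hv.1, hv.2⟩) (rS_subset U Z a)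
    have hY1 : Y \ ↑Z ∪ Sb ⊆ ↑(U \ Z) := Set.union_subset
      (fun v hv => by rw [Finset.coe_sdiff]; exact ⟨hYU hv.1, hv.2⟩) (rS_subset U Z b)
    have IH := ih (U \ Z) hss S S' hSU' hS'U' (X \ ↑Z ∪ Sa) (Y \ ↑Z ∪ Sb) hX1 hY1 F G hF hG hF0 hG0
    have hsub3 : (X ∩ Y) \ ↑Z ∪ rS U Z (a ∩ b) ⊆ (X \ ↑Z ∪ Sa) ∩ (Y \ ↑Z ∪ Sb) := by
      refine Set.union_subset (fun v hv => ⟨Or.inl ⟨hv.1.1, hv.2⟩, Or.inl ⟨hv.1.2, hv.2⟩⟩) ?_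
      exact fun v hv =>
        ⟨Or.inr (rS_inter_subset U Z a b hv).1, Or.inr (rS_inter_subset U Z a b hv).2⟩
    have hsub4 : (X ∪ Y) \ ↑Z ∪ rS U Z (a ∪ b) ⊆ (X \ ↑Z ∪ Sa) ∪ (Y \ ↑Z ∪ Sb) := by
      rw [rS_union]
      rintro v (⟨hXY | hXY, hvZ⟩ | hS | hS)
      · exact Or.inl (Or.inl ⟨hXY, hvZ⟩)
      · exact Or.inr (Or.inl ⟨hXY, hvZ⟩)
      · exact Or.inl (Or.inr hS)
      · exact Or.inr (Or.inr hS)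
    have h2 : blockES w (U \ Z) S' (fun _ => 1) (Y \ ↑Z) Sb =
        ∑ ω, weight w ω * ind (rDS (U \ Z) S' (Y \ ↑Z ∪ Sb)) ω := by
      simp only [blockES, one_mul]
    have h3 : ∑ ω, weight w ω * (F (rCS (U \ Z) (S ∪ S') ω) *
        ind (rDS (U \ Z) (S ∪ S') ((X \ ↑Z ∪ Sa) ∩ (Y \ ↑Z ∪ Sb))) ω) ≤
        blockES w (U \ Z) (S ∪ S') F ((X ∩ Y) \ ↑Z) (rS U Z (a ∩ b)) :=
      sum_ind_mono hw0 hw1 (fun _ => hF0 _) (rDS_antitone hsub3)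
    have h4 : ∑ ω, weight w ω * (G (rCS (U \ Z) (S ∩ S') ω) *
        ind (rDS (U \ Z) (S ∩ S') ((X \ ↑Z ∪ Sa) ∪ (Y \ ↑Z ∪ Sb))) ω) ≤
        blockES w (U \ Z) (S ∩ S') G ((X ∪ Y) \ ↑Z) (rS U Z (a ∪ b)) :=
      sum_ind_mono hw0 hw1 (fun _ => hG0 _) (rDS_antitone hsub4)
    have hIH' : blockES w (U \ Z) S (fun a => F a * G a) (X \ ↑Z) Sa *
        blockES w (U \ Z) S' (fun _ => 1) (Y \ ↑Z) Sb ≤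
        blockES w (U \ Z) (S ∪ S') F ((X ∩ Y) \ ↑Z) (rS U Z (a ∩ b)) *
          blockES w (U \ Z) (S ∩ S') G ((X ∪ Y) \ ↑Z) (rS U Z (a ∪ b)) := by
      rw [h2]
      exact IH.trans (mul_le_mul h3 h4 (sum_ind_nonneg hw0 hw1 (fun _ => hG0 _) _)
        (blockES_nonneg hw0 hw1 _ _ hF0 _ _))
    have hwab := weight_inter_mul_union w a b
    show weight w a * blockES w (U \ Z) S (fun a => F a * G a) (X \ ↑Z) Sa *
        (weight w b * blockES w (U \ Z) S' (fun _ => 1) (Y \ ↑Z) Sb) ≤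
      weight w (a ∩ b) * blockES w (U \ Z) (S ∪ S') F ((X ∩ Y) \ ↑Z) (rS U Z (a ∩ b)) *
        (weight w (a ∪ b) * blockES w (U \ Z) (S ∩ S') G ((X ∪ Y) \ ↑Z) (rS U Z (a ∪ b)))
    calc weight w a * blockES w (U \ Z) S (fun a => F a * G a) (X \ ↑Z) Sa *
          (weight w b * blockES w (U \ Z) S' (fun _ => 1) (Y \ ↑Z) Sb)
        = (weight w a * weight w b) *
          (blockES w (U \ Z) S (fun a => F a * G a) (X \ ↑Z) Sa *
            blockES w (U \ Z) S' (fun _ => 1) (Y \ ↑Z) Sb) := by ring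
      _ ≤ (weight w (a ∩ b) * weight w (a ∪ b)) *
          (blockES w (U \ Z) (S ∪ S') F ((X ∩ Y) \ ↑Z) (rS U Z (a ∩ b)) *
            blockES w (U \ Z) (S ∩ S') G ((X ∪ Y) \ ↑Z) (rS U Z (a ∪ b))) := by
          rw [hwab]
          exact mul_le_mul_of_nonneg_left hIH'
            (mul_nonneg (weight_nonneg hw0 hw1 _) (weight_nonneg hw0 hw1 _))
      _ = _ := by ring

end TwoSource

open TwoSource in
/-- **THEOREM (two-source two-set BHK, MIXED form, measure form).**  For every finite weighted graph (`μ = prodBernoulli w`),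
source sets `S, S'`, repelled sets `X, Y`, `F ≥ 0` increasing and `G ≥ 0` antitone (functions of edge sets, read on the union
clusters `C_A = ⋃_{a∈A} C_a`):
`(∫_{S↮X} F(C_S) G(C_S)) · μ(S'↮Y) ≤ (∫_{S∪S'↮X∩Y} F(C_{S∪S'})) · (∫_{S∩S'↮X∪Y} G(C_{S∩S'}))`.
[cite: VandenbergHaggstromKahn2005, Thm. 1.1 (pp. 3–5), Thm. 1.3 (p. 6) — two-source mixed form derived here] -/
theorem twoSource_twoSet_mixed {V : Type*} [Fintype V] (w : Sym2 V → unitInterval) (S S' X Y : Set V)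
    (F G : Set (Sym2 V) → ℝ) (hF : Monotone F) (hG : Antitone G) (hF0 : ∀ C, 0 ≤ F C) (hG0 : ∀ C, 0 ≤ G C) :
    (∫ ω in {ω : BondConfig V | ∀ s ∈ S, ∀ x ∈ X, ¬ (openGraph ω).Reachable s x},
        F (⋃ s ∈ S, openEdgeCluster ω s) * G (⋃ s ∈ S, openEdgeCluster ω s) ∂(prodBernoulli w)) *
      (prodBernoulli w).real {ω : BondConfig V | ∀ s ∈ S', ∀ x ∈ Y, ¬ (openGraph ω).Reachable s x} ≤
    (∫ ω in {ω : BondConfig V | ∀ s ∈ S ∪ S', ∀ x ∈ X ∩ Y, ¬ (openGraph ω).Reachable s x},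
        F (⋃ s ∈ S ∪ S', openEdgeCluster ω s) ∂(prodBernoulli w)) *
      (∫ ω in {ω : BondConfig V | ∀ s ∈ S ∩ S', ∀ x ∈ X ∪ Y, ¬ (openGraph ω).Reachable s x},
        G (⋃ s ∈ S ∩ S', openEdgeCluster ω s) ∂(prodBernoulli w)) := by
  classical
  set w' : Sym2 V → ℝ := fun e => (w e : ℝ) with hw'
  have hw0 : ∀ e, 0 ≤ w' e := fun e => (w e).2.1
  have hw1 : ∀ e, w' e ≤ 1 := fun e => (w e).2.2
  have hint : ∀ (D : Set (BondConfig V)) (h : Set (Sym2 V) → ℝ),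
      ∫ ω in D, h ω ∂(prodBernoulli w) = ∑ ω, weight w' ω * (h ω * ind D ω) := by
    intro D h
    rw [← integral_indicator (MeasurableSet.of_discrete : MeasurableSet D), integral_prodBernoulli_eq_sum]
    refine Finset.sum_congr rfl fun ω _ => ?_
    by_cases hω : ω ∈ D
    · rw [Set.indicator_of_mem hω, ind_of_mem hω, mul_one]
    · rw [Set.indicator_of_notMem hω, ind_of_not_mem hω]; ring
  have hreal : ∀ D : Set (BondConfig V), (prodBernoulli w).real D = ∑ ω, weight w' ω * ind D ω := by
    intro D
    rw [← integral_indicator_one (MeasurableSet.of_discrete : MeasurableSet D),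
      integral_prodBernoulli_eq_sum]
    refine Finset.sum_congr rfl fun ω _ => ?_
    by_cases hω : ω ∈ D
    · rw [Set.indicator_of_mem hω, ind_of_mem hω, Pi.one_apply]
    · rw [Set.indicator_of_notMem hω, ind_of_not_mem hω, mul_zero]
  have hm : ∑ ω, weight w' ω = 1 := by
    have h1 := integral_prodBernoulli_eq_sum w fun _ => (1 : ℝ)
    simp only [integral_const, probReal_univ, smul_eq_mul, mul_one] at h1
    exact h1.symm
  have hE : ∀ ω : Set (Sym2 V), ω ∩ BHK2006.edgesIn (Finset.univ : Finset V) = ω := fun ω => by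
    ext e
    simp only [Set.mem_inter_iff, BHK2006.edgesIn, Set.mem_setOf_eq, Finset.mem_univ, imp_true_iff,
      and_true]
  have hC : ∀ (A : Set V) (ω : Set (Sym2 V)), rCS Finset.univ A ω = ⋃ s ∈ A, openEdgeCluster ω s :=
    fun A ω => by simp only [rCS, rC, hE]
  have hDD : ∀ (A W : Set V), rDS Finset.univ A W =
      {ω : BondConfig V | ∀ s ∈ A, ∀ x ∈ W, ¬ (openGraph ω).Reachable s x} := fun A W => by
    ext ω
    simp only [rDS, hE, Set.mem_setOf_eq]
  have hsub : ∀ A : Set V, A ⊆ ↑(Finset.univ : Finset V) := fun A => by simp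
  have key := core₂_mixed w' hw0 hw1 hm Finset.univ S S' (hsub S) (hsub S') X Y (hsub X) (hsub Y)
    F G hF hG hF0 hG0
  simp only [hC, hDD] at key
  rw [hint, hint, hint, hreal]
  exact key

/-- **One source set, two repelled sets, MIXED form.**  For `F ≥ 0` increasing and `G ≥ 0` antitone:
`(∫_{S↮X} F(C_S) G(C_S)) · μ(S↮Y) ≤ (∫_{S↮X∩Y} F(C_S)) · (∫_{S↮X∪Y} G(C_S))` — the increasing functional moves to the
SMALLER repelled set, the decreasing one to the LARGER.  At `X = Y` this is van den Berg–Häggström–Kahn's Theorem 1.3 for one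
increasing and one decreasing function (negative correlation given `{S ↮ X}`).
[cite: VandenbergHaggstromKahn2005, Thm. 1.3 (p. 6) with Remark 2 after Thm. 1.2 (p. 5) — two-repelled-set form derived here] -/
theorem twoSource_sameSource_mixed {V : Type*} [Fintype V] (w : Sym2 V → unitInterval) (S X Y : Set V)
    (F G : Set (Sym2 V) → ℝ) (hF : Monotone F) (hG : Antitone G) (hF0 : ∀ C, 0 ≤ F C) (hG0 : ∀ C, 0 ≤ G C) :
    (∫ ω in {ω : BondConfig V | ∀ s ∈ S, ∀ x ∈ X, ¬ (openGraph ω).Reachable s x},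
        F (⋃ s ∈ S, openEdgeCluster ω s) * G (⋃ s ∈ S, openEdgeCluster ω s) ∂(prodBernoulli w)) *
      (prodBernoulli w).real {ω : BondConfig V | ∀ s ∈ S, ∀ x ∈ Y, ¬ (openGraph ω).Reachable s x} ≤
    (∫ ω in {ω : BondConfig V | ∀ s ∈ S, ∀ x ∈ X ∩ Y, ¬ (openGraph ω).Reachable s x},
        F (⋃ s ∈ S, openEdgeCluster ω s) ∂(prodBernoulli w)) *
      (∫ ω in {ω : BondConfig V | ∀ s ∈ S, ∀ x ∈ X ∪ Y, ¬ (openGraph ω).Reachable s x},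
        G (⋃ s ∈ S, openEdgeCluster ω s) ∂(prodBernoulli w)) := by
  have key := twoSource_twoSet_mixed w S S X Y F G hF hG hF0 hG0
  simp only [Set.union_self, Set.inter_self] at key
  exact key

end Consts

end Summit.CriticalPhenomena.PercolationContinuityZ3.Theorems

end
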